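import Mathlib
import Summits.ValiantsHypothesis.ValiantsHypothesis.Theorems.DivisionGapZeroOneTransferFaceIsolationDefs
import Summits.ValiantsHypothesis.ValiantsHypothesis.Theorems.DivisionGapZeroOneTransferBrickZoneUnique
import Summits.ValiantsHypothesis.ValiantsHypothesis.Theorems.DivisionGapZeroOneTransferBrickWallTiling

/-!
# Crux `DivisionGap.ZeroOneTransfer` (stmt-ValiantsHypothesis-5066), line `charged-uncharged`, Part E (lead c13) —
stub `stub_ringCover` (E5, THE RING COVER)

For the block `B' = [2, m - 2) × [b + 2, b + m - 2)` sitting inside the first brick zone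
`Z1 = {zone cells of the rows < m}` of rung E-I we show: (a) every triangular edge with both ends in
`B'` lies in the edge predicate `E0sq m b` (both ends are cells of zone `0`); (b) the complement of `B'`
carries a fixed-point-free involution `g` along triangular edges, inside `E0sq` and avoiding `B'`: off
`Z1` it is the explicit tiling `u₀` (which maps the complement of `Z1` to itself, `Z1` being a union of
bricks, i.e. of `u₀`-dominoes), and on the ring `Z1 \ B'` it is an explicit matching along triangular
edges inside zone `0` — bricks in the rows `0, 1, m - 2, m - 1`, and in the rows `2 ≤ i ≤ m - 3`
(chunks of four rows starting at `i ≡ 2 (mod 4)`, which is where `4 ∣ m` enters) the pattern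
`{A–C, B–D, E–G, F–H, I–J}` on the left cells `A = (i, b)`, `B = (i, b+1)`, `C = (i+1, b-1)`,
`D = (i+1, b)`, `E = (i+1, b+1)`, `F = (i+2, b)`, `G = (i+2, b+1)`, `H = (i+3, b-1)`, `I = (i+3, b)`,
`J = (i+3, b+1)` and `{A'–B', E'–D', F'–C', H'–G', J'–I'}` on the right cells `A' = (i, b+m-2)`,
`B' = (i, b+m-1)`, `C' = (i+1, b+m-2)`, `D' = (i+1, b+m-1)`, `E' = (i+1, b+m)`, `F' = (i+2, b+m-2)`,
`G' = (i+2, b+m-1)`, `H' = (i+3, b+m-2)`, `I' = (i+3, b+m-1)`, `J' = (i+3, b+m)` (the table was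
also checked by computer for all admissible `(n, m, b)` with `n ≤ 70`).  The ring partner is an
`if`-table `R` on `ℕ × ℕ` in the row class `i % 4` and the column (hypothesis `hR` of the `RingCover`
lemmas, instantiated in the stub);
`RingCover.ring_mid` evaluates the table at each of the 20 cell types of the middle rows and at their
partners (involution, first zone, off the block, triangular adjacency — linear arithmetic discharged
by `omega`), `RingCover.ring_main` adds the brick rows, and the cover `g` is the lift of `R` to
vertices on the ring and `u₀` elsewhere. [folklore]
-/

noncomputable section

set_option linter.dupNamespace false

namespace Summit.ValiantsHypothesis.ValiantsHypothesis.Theorems.DivisionGapZeroOneTransfer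

open MvPolynomial
open Literature.Computability.AlgebraicComplexity
open Summit.ValiantsHypothesis.ValiantsHypothesis.Theorems.TriangularDimersDivisionEasy.Negative
open FaceIsolation
open scoped NNReal BigOperators

namespace RingCover

open BrickZoneUnique U0Tiling

/-- The brick partner of a zone cell (`m`, `b` even): same row, again in the zone, an involution, and
the horizontal neighbour. [folklore] -/
theorem brick_spec {m b i j : ℕ} (hm2 : m % 2 = 0) (hb2 : b % 2 = 0) (hmb : m + 2 ≤ b)
    (hz : inZoneNat m b (i, j)) :
    (brick m (i, j)).1 = i ∧ inZoneNat m b (brick m (i, j)) ∧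
    brick m (brick m (i, j)) = (i, j) ∧
    ((brick m (i, j)).2 = j + 1 ∨ (brick m (i, j)).2 + 1 = j) := by
  have hz' := (inZoneNat_iff m b i j).1 hz
  cases hl : zoneLeft m (i, j)
  · have hl' := (zoneLeft_eq_false_iff m i j).1 hl
    have hl2 : zoneLeft m (i, j - 1) = true := by rw [zoneLeft_iff]; omega
    rw [brick_of_right hl, brick_of_left hl2, inZoneNat_iff]
    exact ⟨rfl, by omega, pair_eq rfl (by omega), Or.inr (by omega)⟩
  · have hl' := (zoneLeft_iff m i j).1 hl
    have hl2 : zoneLeft m (i, j + 1) = false := by rw [zoneLeft_eq_false_iff]; omega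
    rw [brick_of_left hl, brick_of_right hl2, inZoneNat_iff]
    exact ⟨rfl, by omega, pair_eq rfl (by omega), Or.inl rfl⟩

/-- **The ring matching in the rows `2 ≤ i ≤ m - 3` (on `ℕ × ℕ`).**  `R` is the table of the ring
partner: bricks in the rows `0, 1, m - 2, m - 1`, and in the other rows, by the row class `i % 4` and
the column, the four-row pattern of the file header written relative to the cell (`4 ∣ m`, `8 ≤ m`,
`m + 2 ≤ b`).  For a first-zone cell `(i, j)` off the block `B'` in a row `2 ≤ i ≤ m - 3` — these are
the 20 cell types `i % 4 ∈ {0, 2}`, `j ∈ {b, b+1, b+m-2, b+m-1}` and `i % 4 ∈ {1, 3}`,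
`j ∈ {b-1, b, b+1, b+m-2, b+m-1, b+m}` — the table is evaluated at the cell and at its partner
`(k, l)`: `R (k, l) = (i, j)`, `(k, l)` is a first-zone cell (wide/narrow column range by the parity
of `k`) off `B'`, at triangular distance one from `(i, j)`. [folklore] -/
theorem ring_mid {m b i j : ℕ} {R : ℕ × ℕ → ℕ × ℕ}
    (hR : ∀ i j, R (i, j) =
      if i < 2 ∨ m ≤ i + 2 then brick m (i, j)
      else if i % 4 = 2 then
        (if j ≤ b + 1 then (i + 1, j - 1) else if j + 2 = b + m then (i, j + 1) else (i, j - 1))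
      else if i % 4 = 3 then
        (if j ≤ b then (i - 1, j + 1) else if j = b + 1 ∨ j + 2 = b + m then (i + 1, j)
         else if j + 1 = b + m then (i, j + 1) else (i, j - 1))
      else if i % 4 = 0 then
        (if j = b ∨ j + 1 = b + m then (i + 1, j - 1) else (i - 1, j))
      else
        (if j + 1 = b ∨ j + 2 = b + m then (i - 1, j + 1)
         else if j = b ∨ j + 1 = b + m then (i, j + 1) else (i, j - 1)))
    (hm4 : m % 4 = 0) (h8 : 8 ≤ m) (hmb : m + 2 ≤ b) (hrow : ¬ (i < 2 ∨ m ≤ i + 2))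
    (hz : inZoneNat m b (i, j))
    (hB : ¬ (2 ≤ i ∧ i < 2 + (m - 4) ∧ b + 2 ≤ j ∧ j < b + 2 + (m - 4))) {k l : ℕ}
    (hq : R (i, j) = (k, l)) :
    R (k, l) = (i, j) ∧ k < m ∧
    ((k % 2 = 1 ∧ b - 1 ≤ l ∧ l ≤ b + m) ∨ (k % 2 = 0 ∧ b ≤ l ∧ l + 1 ≤ b + m)) ∧
    ¬ (2 ≤ k ∧ k < 2 + (m - 4) ∧ b + 2 ≤ l ∧ l < b + 2 + (m - 4)) ∧
    (k ≤ i + 1 ∧ i ≤ k + 1 ∧ l ≤ j + 1 ∧ j ≤ l + 1 ∧ k + l ≤ i + j + 1 ∧ i + j ≤ k + l + 1 ∧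
      (k ≠ i ∨ l ≠ j)) := by
  rw [inZoneNat_iff] at hz
  obtain hpar | hpar := Nat.mod_two_eq_zero_or_one i
  · -- even (narrow) rows: the cells `j ∈ {b, b + 1, b + m - 2, b + m - 1}`
    obtain ⟨hzb, hzt⟩ := hz.2.2 (by omega)
    clear hz
    have hj4 : j = b ∨ j = b + 1 ∨ j + 2 = b + m ∨ j + 1 = b + m := by omega
    have hr2 : i % 4 = 0 ∨ i % 4 = 2 := by omega
    clear hB hzb hzt hpar
    rcases hr2 with hr | hr <;> rcases hj4 with hj | hj | hj | hj
    all_goals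
      rw [hR i, if_neg hrow] at hq
      repeat (first | rw [if_neg (by omega)] at hq | rw [if_pos (by omega)] at hq)
      obtain ⟨hk1, hk2⟩ := Prod.mk.inj hq
      rw [← hk1, ← hk2]
      refine ⟨?_, by omega, by omega, by omega, by omega⟩
      rw [hR, if_neg (by omega)]
      repeat (first | rw [if_neg (by omega)] | rw [if_pos (by omega)])
      exact pair_eq (by omega) (by omega)
  · -- odd (wide) rows: the cells `j ∈ {b - 1, b, b + 1, b + m - 2, b + m - 1, b + m}`
    obtain ⟨hzb, hzt⟩ := hz.2.1 (Or.inl ⟨by omega, hpar⟩)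
    clear hz
    have hj6 : j + 1 = b ∨ j = b ∨ j = b + 1 ∨ j + 2 = b + m ∨ j + 1 = b + m ∨ j = b + m := by
      omega
    have hr2 : i % 4 = 1 ∨ i % 4 = 3 := by omega
    clear hB hzb hzt hpar
    rcases hr2 with hr | hr <;> rcases hj6 with hj | hj | hj | hj | hj | hj
    all_goals
      rw [hR i, if_neg hrow] at hq
      repeat (first | rw [if_neg (by omega)] at hq | rw [if_pos (by omega)] at hq)
      obtain ⟨hk1, hk2⟩ := Prod.mk.inj hq
      rw [← hk1, ← hk2]
      refine ⟨?_, by omega, by omega, by omega, by omega⟩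
      rw [hR, if_neg (by omega)]
      repeat (first | rw [if_neg (by omega)] | rw [if_pos (by omega)])
      exact pair_eq (by omega) (by omega)

/-- **The ring matching (on `ℕ × ℕ`).**  With `R` the table of `ring_mid`: for every first-zone cell
`(i, j)` (`i < m`) off the block `B'`, with partner `(k, l) = R (i, j)`: `R (k, l) = (i, j)`, `(k, l)`
is a first-zone cell off `B'`, and it lies at triangular distance one from `(i, j)` (so `(k, l) ≠ (i, j)`
and `Adj`).  The rows `0, 1, m - 2, m - 1` are matched by bricks (`brick_spec`), the others by
`ring_mid`. [folklore] -/
theorem ring_main {m b i j : ℕ} {R : ℕ × ℕ → ℕ × ℕ}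
    (hR : ∀ i j, R (i, j) =
      if i < 2 ∨ m ≤ i + 2 then brick m (i, j)
      else if i % 4 = 2 then
        (if j ≤ b + 1 then (i + 1, j - 1) else if j + 2 = b + m then (i, j + 1) else (i, j - 1))
      else if i % 4 = 3 then
        (if j ≤ b then (i - 1, j + 1) else if j = b + 1 ∨ j + 2 = b + m then (i + 1, j)
         else if j + 1 = b + m then (i, j + 1) else (i, j - 1))
      else if i % 4 = 0 then
        (if j = b ∨ j + 1 = b + m then (i + 1, j - 1) else (i - 1, j))
      else
        (if j + 1 = b ∨ j + 2 = b + m then (i - 1, j + 1)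
         else if j = b ∨ j + 1 = b + m then (i, j + 1) else (i, j - 1)))
    (hm4 : m % 4 = 0) (hb2 : b % 2 = 0) (h8 : 8 ≤ m) (hmb : m + 2 ≤ b) (hi : i < m)
    (hz : inZoneNat m b (i, j))
    (hB : ¬ (2 ≤ i ∧ i < 2 + (m - 4) ∧ b + 2 ≤ j ∧ j < b + 2 + (m - 4))) {k l : ℕ}
    (hq : R (i, j) = (k, l)) :
    R (k, l) = (i, j) ∧ k < m ∧ inZoneNat m b (k, l) ∧
    ¬ (2 ≤ k ∧ k < 2 + (m - 4) ∧ b + 2 ≤ l ∧ l < b + 2 + (m - 4)) ∧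
    (k ≤ i + 1 ∧ i ≤ k + 1 ∧ l ≤ j + 1 ∧ j ≤ l + 1 ∧ k + l ≤ i + j + 1 ∧ i + j ≤ k + l + 1 ∧
      (k ≠ i ∨ l ≠ j)) := by
  by_cases hrow : i < 2 ∨ m ≤ i + 2
  · -- the rows `0, 1, m - 2, m - 1`: bricks
    clear hB
    obtain ⟨hb1, hbz, hbb, hb4⟩ := brick_spec (by omega) hb2 hmb hz
    rw [hR i j, if_pos hrow] at hq
    rw [hq] at hb1 hbz hbb hb4
    dsimp only at hb1 hb4
    refine ⟨?_, by omega, hbz, by omega, by omega⟩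
    rw [hR k l, if_pos (by omega), hbb]
  · -- the rows `2 ≤ i ≤ m - 3`
    obtain ⟨h1, h2, h3, h4, h5⟩ := ring_mid hR hm4 h8 hmb hrow hz hB hq
    refine ⟨h1, h2, ?_, h4, h5⟩
    rw [inZoneNat_iff]
    omega

end RingCover

open BrickZoneUnique U0Tiling RingCover in
/-- **Stub E5 — THE RING COVER.**  For the block `B' = [2, m - 2) × [b + 2, b + m - 2)` inside the
first brick zone: (a) triangular edges with both ends in `B'` are in `E0sq m b` (zone `0`); (b) there is
a fixed-point-free involution `g` along triangular edges on the complement of `B'`, inside `E0sq m b` and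
avoiding `B'`: `u₀` off the first zone and the explicit ring matching of `RingCover.ring_main` on the
ring `Z1 \ B'`. [folklore] -/
theorem stub_ringCover : ∀ (n m b : ℕ), Even n → m % 4 = 0 → Even b → 8 ≤ m → m + 2 ≤ b →
    b + 2 * m + 2 ≤ n → IsSqDimer (u0 (n := n) m b) →
    (∀ v : Vtx n, ((u0 m b v).1 : ℕ) = (u0Nat m b ((v.1 : ℕ), (v.2 : ℕ))).1 ∧
      ((u0 m b v).2 : ℕ) = (u0Nat m b ((v.1 : ℕ), (v.2 : ℕ))).2) →
    (∀ v w : Vtx n, InBlock 2 (b + 2) (m - 4) v → InBlock 2 (b + 2) (m - 4) w → Adj v w →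
      E0sq m b v w) ∧
    ∃ g : Vtx n → Vtx n, ∀ v, ¬ InBlock 2 (b + 2) (m - 4) v →
      g (g v) = v ∧ g v ≠ v ∧ Adj v (g v) ∧ ¬ InBlock 2 (b + 2) (m - 4) (g v) ∧ E0sq m b v (g v) := by
  intro n m b _hn hm4 hb h8 hmb hbn hsq hco
  have hb2 : b % 2 = 0 := Nat.even_iff.1 hb
  have hm2 : m % 2 = 0 := by omega
  -- the block `B'` lies in the first zone `Z1` (the zone cells of the rows `< m`)
  have hBZ : ∀ v : Vtx n, InBlock 2 (b + 2) (m - 4) v → InZone m b v ∧ (v.1 : ℕ) < m := by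
    intro v hv
    unfold InBlock at hv
    unfold InZone
    rw [inZoneNat_iff]
    omega
  -- `Z1` is zone `0`
  have hzone0 : ∀ v : Vtx n, InZone m b v ∧ (v.1 : ℕ) < m → zone m b 0 v := by
    intro v hv
    unfold zone
    rw [if_pos rfl]
    exact hv
  refine ⟨fun v w hv hw hadj => Or.inl ⟨0, hzone0 v (hBZ v hv), hzone0 w (hBZ w hw), hadj⟩, ?_⟩
  -- the ring partner on `ℕ × ℕ` (the table of `RingCover.ring_mid`)
  obtain ⟨R, hR⟩ : ∃ R : ℕ × ℕ → ℕ × ℕ, ∀ i j, R (i, j) =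
      if i < 2 ∨ m ≤ i + 2 then brick m (i, j)
      else if i % 4 = 2 then
        (if j ≤ b + 1 then (i + 1, j - 1) else if j + 2 = b + m then (i, j + 1) else (i, j - 1))
      else if i % 4 = 3 then
        (if j ≤ b then (i - 1, j + 1) else if j = b + 1 ∨ j + 2 = b + m then (i + 1, j)
         else if j + 1 = b + m then (i, j + 1) else (i, j - 1))
      else if i % 4 = 0 then
        (if j = b ∨ j + 1 = b + m then (i + 1, j - 1) else (i - 1, j))
      else
        (if j + 1 = b ∨ j + 2 = b + m then (i - 1, j + 1)
         else if j = b ∨ j + 1 = b + m then (i, j + 1) else (i, j - 1)) :=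
    ⟨fun p =>
      if p.1 < 2 ∨ m ≤ p.1 + 2 then brick m (p.1, p.2)
      else if p.1 % 4 = 2 then
        (if p.2 ≤ b + 1 then (p.1 + 1, p.2 - 1) else if p.2 + 2 = b + m then (p.1, p.2 + 1)
         else (p.1, p.2 - 1))
      else if p.1 % 4 = 3 then
        (if p.2 ≤ b then (p.1 - 1, p.2 + 1) else if p.2 = b + 1 ∨ p.2 + 2 = b + m then (p.1 + 1, p.2)
         else if p.2 + 1 = b + m then (p.1, p.2 + 1) else (p.1, p.2 - 1))
      else if p.1 % 4 = 0 then
        (if p.2 = b ∨ p.2 + 1 = b + m then (p.1 + 1, p.2 - 1) else (p.1 - 1, p.2))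
      else
        (if p.2 + 1 = b ∨ p.2 + 2 = b + m then (p.1 - 1, p.2 + 1)
         else if p.2 = b ∨ p.2 + 1 = b + m then (p.1, p.2 + 1) else (p.1, p.2 - 1)),
      fun _ _ => rfl⟩
  -- the cover `g`: the lift of `R` on the ring, `u₀` off the first zone
  obtain ⟨g, hg1, hg2⟩ : ∃ g : Vtx n → Vtx n,
      (∀ v : Vtx n, (InZone m b v ∧ (v.1 : ℕ) < m) →
        ∀ h : (R ((v.1 : ℕ), (v.2 : ℕ))).1 < n ∧ (R ((v.1 : ℕ), (v.2 : ℕ))).2 < n,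
          g v = (⟨_, h.1⟩, ⟨_, h.2⟩)) ∧
      (∀ v : Vtx n, ¬ (InZone m b v ∧ (v.1 : ℕ) < m) → g v = u0 m b v) := by
    refine ⟨fun v => if InZone m b v ∧ (v.1 : ℕ) < m then
        (if h : (R ((v.1 : ℕ), (v.2 : ℕ))).1 < n ∧ (R ((v.1 : ℕ), (v.2 : ℕ))).2 < n then
          (⟨_, h.1⟩, ⟨_, h.2⟩) else v) else u0 m b v, ?_, ?_⟩
    · intro v hv h
      simp only [if_pos hv, dif_pos h]
    · intro v hv
      simp only [if_neg hv]
  refine ⟨g, fun v hv => ?_⟩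
  by_cases hz1 : InZone m b v ∧ (v.1 : ℕ) < m
  · -- on the ring `Z1 \ B'`
    have hB' : ¬ (2 ≤ (v.1 : ℕ) ∧ (v.1 : ℕ) < 2 + (m - 4) ∧ b + 2 ≤ (v.2 : ℕ) ∧
        (v.2 : ℕ) < b + 2 + (m - 4)) := hv
    obtain ⟨hinv, hrow, hzq, hBq, hadj⟩ := ring_main hR hm4 hb2 h8 hmb hz1.2 hz1.1 hB'
      (Prod.mk.eta (p := R ((v.1 : ℕ), (v.2 : ℕ)))).symm
    have hlt : (R ((v.1 : ℕ), (v.2 : ℕ))).1 < n ∧ (R ((v.1 : ℕ), (v.2 : ℕ))).2 < n := by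
      have h' := (inZoneNat_iff m b _ _).1 hzq
      omega
    rw [hg1 v hz1 hlt]
    have hzw : InZone m b ((⟨_, hlt.1⟩, ⟨_, hlt.2⟩) : Vtx n) ∧
        (((⟨(R ((v.1 : ℕ), (v.2 : ℕ))).1, hlt.1⟩, ⟨_, hlt.2⟩) : Vtx n).1 : ℕ) < m := ⟨hzq, hrow⟩
    have hadj' : Adj v ((⟨_, hlt.1⟩, ⟨_, hlt.2⟩) : Vtx n) := by
      unfold Adj
      dsimp only
      omega
    refine ⟨?_, ?_, hadj', hBq, Or.inl ⟨0, hzone0 v hz1, hzone0 _ hzw, hadj'⟩⟩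
    · -- involution
      have hlt' : (R ((R ((v.1 : ℕ), (v.2 : ℕ))).1, (R ((v.1 : ℕ), (v.2 : ℕ))).2)).1 < n ∧
          (R ((R ((v.1 : ℕ), (v.2 : ℕ))).1, (R ((v.1 : ℕ), (v.2 : ℕ))).2)).2 < n := by
        rw [hinv]
        exact ⟨v.1.2, v.2.2⟩
      rw [hg1 _ hzw hlt']
      refine Prod.ext (Fin.ext ?_) (Fin.ext ?_)
      · show (R ((R ((v.1 : ℕ), (v.2 : ℕ))).1, (R ((v.1 : ℕ), (v.2 : ℕ))).2)).1 = (v.1 : ℕ)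
        rw [hinv]
      · show (R ((R ((v.1 : ℕ), (v.2 : ℕ))).1, (R ((v.1 : ℕ), (v.2 : ℕ))).2)).2 = (v.2 : ℕ)
        rw [hinv]
    · -- no fixed point
      intro heq
      have h1 : (R ((v.1 : ℕ), (v.2 : ℕ))).1 = (v.1 : ℕ) := congrArg (fun w : Vtx n => (w.1 : ℕ)) heq
      have h2 : (R ((v.1 : ℕ), (v.2 : ℕ))).2 = (v.2 : ℕ) := congrArg (fun w : Vtx n => (w.2 : ℕ)) heq
      omega
  · -- off the first zone: `u₀`, which maps the complement of `Z1` to itself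
    rw [hg2 v hz1]
    have hz2 : ¬ (InZone m b (u0 m b v) ∧ ((u0 m b v).1 : ℕ) < m) := by
      rintro ⟨hzw, hwm⟩
      obtain ⟨e1, e2⟩ := hco (u0 m b v)
      rw [(hsq v).1] at e1 e2
      have h2m : ¬ 2 * m ≤ ((u0 m b v).1 : ℕ) := by omega
      rw [u0Nat_zone h2m hzw] at e1 e2
      obtain ⟨hb1, hbz, -, -⟩ := brick_spec hm2 hb2 hmb hzw
      apply hz1
      refine ⟨?_, by omega⟩
      unfold InZone
      rw [e1, e2, Prod.mk.eta]
      exact hbz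
    refine ⟨?_, (hsq v).2.1, adj_of_sqAdj (hsq v).2.2, fun hB => hz2 (hBZ _ hB), Or.inr rfl⟩
    rw [hg2 _ hz2]
    exact (hsq v).1

end Summit.ValiantsHypothesis.ValiantsHypothesis.Theorems.DivisionGapZeroOneTransfer

end
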